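import Literature.NumberTheory.DiophantineGeometry.PlaneSectionBookkeepingProofs
import HarnessLib

/-!
# Shape of the generic plane section `χ = f(μ + vX + Y·Z)`

For a field `E`, `f ∈ E[x₁, …, xₙ]` of total degree `δ` and `μ, v ∈ Eⁿ`, the restriction of
`f` to the planes through the line `{μ + Xv}`,

  `χ = f(μ₁ + v₁X + Z₁Y, …, μₙ + vₙX + ZₙY) ∈ E[Z][Y][X]`

(`E[Z] = MvPolynomial (Fin n) E` the ring of plane parameters; outer variable `X`, inner `Y`),
has the following elementary shape, used by the Newton–Hensel / linear-algebra argument of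
Kaltofen's effective Bertini theorem (Cafure–Matera 2006, §3.2; the degree bookkeeping behind
"`deg Υ ≤ …`" in Thm. 3.3 and Cor. 3.2):

* `filtration_planeSubst`: the coefficient of `Xᵉ Yʲ` has `Z`-degree `≤ j` (each `Zᵢ` comes with
  a factor `Y`); this *degree filtration* is stable under sums, products and evaluation at elements
  of `E[Z][Y]` satisfying it (`filtrationY_eval`), hence under the Newton step
  (`filtrationY_newton_step`);
* `coeff_planeSubst_totalDegree`, `natDegree_planeSubst`, `natDegree_coeff_planeSubst_le`: `χ` has
  `X`-degree `δ` with constant leading coefficient `f_δ(v)` (top homogeneous component of `f` at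
  `v`) when `f_δ(v) ≠ 0`, and its `X`-coefficients have `Y`-degree `≤ δ`;
* `map_evalRingHom_zero_planeSubst`: `χ(X, 0, Z) = g(X) = f(μ + Xv)` does not involve `Z`.

No definitions: the filtration is spelled `∀ j, totalDegree (coeff j) ≤ j`, `χ`, `g` are the
displayed `MvPolynomial.aeval` terms (as in `BertiniSubstitutionProofs`).

## References

* E. Kaltofen, J. Comput. System Sci. 50 (1995) 274–295, §3 (proof of Thm. 5, degree counts).
  [Kaltofen1995]
* A. Cafure, G. Matera, Finite Fields Appl. 12 (2006) 155–185, §3.2, proof of Thm. 3.3.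
  [CafureMatera2006]
-/

noncomputable section

open scoped Classical Polynomial
open MvPolynomial

namespace Literature.NumberTheory.DiophantineGeometry

universe u v

variable {E : Type u} [Field E] {σ : Type v}

/-! ### The degree filtration on `E[Z][Y]` and `E[Z][Y][X]`

`FilY a :⇔ ∀ j, totalDegree (a.coeff j) ≤ j` for `a ∈ E[Z][Y]`, and `Fil P :⇔ ∀ e, FilY (P.coeff e)`
for `P ∈ E[Z][Y][X]`; both written out. -/

section Filtration

/-- The filtration is additive. [folklore] -/
theorem filtrationY_add {a b : Polynomial (MvPolynomial σ E)}
    (ha : ∀ j, (a.coeff j).totalDegree ≤ j) (hb : ∀ j, (b.coeff j).totalDegree ≤ j) :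
    ∀ j, ((a + b).coeff j).totalDegree ≤ j := fun j ↦ by
  rw [Polynomial.coeff_add]
  exact (totalDegree_add _ _).trans (max_le (ha j) (hb j))

/-- The filtration is stable under negation. [folklore] -/
theorem filtrationY_neg {a : Polynomial (MvPolynomial σ E)}
    (ha : ∀ j, (a.coeff j).totalDegree ≤ j) : ∀ j, ((-a).coeff j).totalDegree ≤ j := fun j ↦ by
  rw [Polynomial.coeff_neg, totalDegree_neg]
  exact ha j

/-- The filtration is stable under subtraction. [folklore] -/
theorem filtrationY_sub {a b : Polynomial (MvPolynomial σ E)}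
    (ha : ∀ j, (a.coeff j).totalDegree ≤ j) (hb : ∀ j, (b.coeff j).totalDegree ≤ j) :
    ∀ j, ((a - b).coeff j).totalDegree ≤ j := by
  rw [sub_eq_add_neg]
  exact filtrationY_add ha (filtrationY_neg hb)

/-- The filtration is multiplicative. [folklore] -/
theorem filtrationY_mul {a b : Polynomial (MvPolynomial σ E)}
    (ha : ∀ j, (a.coeff j).totalDegree ≤ j) (hb : ∀ j, (b.coeff j).totalDegree ≤ j) :
    ∀ j, ((a * b).coeff j).totalDegree ≤ j := fun j ↦ by
  rw [Polynomial.coeff_mul]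
  refine totalDegree_finsetSum_le fun x hx ↦ ?_
  rw [Finset.mem_antidiagonal] at hx
  calc (a.coeff x.1 * b.coeff x.2).totalDegree
      ≤ (a.coeff x.1).totalDegree + (b.coeff x.2).totalDegree := totalDegree_mul _ _
    _ ≤ x.1 + x.2 := Nat.add_le_add (ha _) (hb _)
    _ = j := hx

/-- Finite sums respect the filtration. [folklore] -/
theorem filtrationY_sum {ι : Type*} (s : Finset ι) {g : ι → Polynomial (MvPolynomial σ E)}
    (hg : ∀ i ∈ s, ∀ j, ((g i).coeff j).totalDegree ≤ j) :
    ∀ j, ((∑ i ∈ s, g i).coeff j).totalDegree ≤ j := by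
  induction s using Finset.induction_on with
  | empty => intro j; simp
  | insert a s has ih =>
    rw [Finset.sum_insert has]
    exact filtrationY_add (hg a (Finset.mem_insert_self _ _))
      (ih fun i hi ↦ hg i (Finset.mem_insert_of_mem hi))

/-- Powers respect the filtration. [folklore] -/
theorem filtrationY_pow {a : Polynomial (MvPolynomial σ E)}
    (ha : ∀ j, (a.coeff j).totalDegree ≤ j) (m : ℕ) : ∀ j, ((a ^ m).coeff j).totalDegree ≤ j := by
  induction m with
  | zero => intro j; rw [pow_zero, Polynomial.coeff_one]; split_ifs <;> simp
  | succ m ih => rw [pow_succ]; exact filtrationY_mul ih ha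

/-- Constants `c ∈ E` lie in the filtration. [folklore] -/
theorem filtrationY_C_C (c : E) :
    ∀ j, ((Polynomial.C (C c) : Polynomial (MvPolynomial σ E)).coeff j).totalDegree ≤ j := by
  intro j
  rw [Polynomial.coeff_C]
  split_ifs <;> simp

/-- `Zᵢ · Y` lies in the filtration. [folklore] -/
theorem filtrationY_X_mul_Y (i : σ) :
    ∀ j, ((Polynomial.C (X i) * Polynomial.X : Polynomial (MvPolynomial σ E)).coeff j).totalDegree
      ≤ j := by
  intro j
  rw [Polynomial.coeff_C_mul_X]
  split_ifs with h
  · subst h; rw [totalDegree_X]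
  · simp

/-- **Evaluation respects the filtration:** if every `X`-coefficient of `P ∈ E[Z][Y][X]` and
`a ∈ E[Z][Y]` lie in the filtration then so does `P(a)`. [folklore] -/
theorem filtrationY_eval {P : Polynomial (Polynomial (MvPolynomial σ E))}
    (hP : ∀ e j, ((P.coeff e).coeff j).totalDegree ≤ j) {a : Polynomial (MvPolynomial σ E)}
    (ha : ∀ j, (a.coeff j).totalDegree ≤ j) : ∀ j, ((P.eval a).coeff j).totalDegree ≤ j := by
  rw [Polynomial.eval_eq_sum_range]
  exact filtrationY_sum _ fun e _ ↦ filtrationY_mul (hP e) (filtrationY_pow ha e)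

/-- **The Newton step respects the filtration:** with `u ∈ E` a constant,
`a ↦ a - u χ(a)` preserves it. [folklore] -/
theorem filtrationY_newton_step {χ : Polynomial (Polynomial (MvPolynomial σ E))}
    (hχ : ∀ e j, ((χ.coeff e).coeff j).totalDegree ≤ j) (u : E)
    {a : Polynomial (MvPolynomial σ E)} (ha : ∀ j, (a.coeff j).totalDegree ≤ j) :
    ∀ j, ((a - Polynomial.C (C u) * χ.eval a).coeff j).totalDegree ≤ j :=
  filtrationY_sub ha (filtrationY_mul (filtrationY_C_C u) (filtrationY_eval hχ ha))

/-- The filtration on `E[Z][Y][X]` is additive. [folklore] -/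
theorem filtration_add {P Q : Polynomial (Polynomial (MvPolynomial σ E))}
    (hP : ∀ e j, ((P.coeff e).coeff j).totalDegree ≤ j)
    (hQ : ∀ e j, ((Q.coeff e).coeff j).totalDegree ≤ j) :
    ∀ e j, (((P + Q).coeff e).coeff j).totalDegree ≤ j := fun e ↦ by
  rw [Polynomial.coeff_add]
  exact filtrationY_add (hP e) (hQ e)

/-- The filtration on `E[Z][Y][X]` is multiplicative. [folklore] -/
theorem filtration_mul {P Q : Polynomial (Polynomial (MvPolynomial σ E))}
    (hP : ∀ e j, ((P.coeff e).coeff j).totalDegree ≤ j)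
    (hQ : ∀ e j, ((Q.coeff e).coeff j).totalDegree ≤ j) :
    ∀ e j, (((P * Q).coeff e).coeff j).totalDegree ≤ j := fun e ↦ by
  rw [Polynomial.coeff_mul]
  exact filtrationY_sum _ fun x _ ↦ filtrationY_mul (hP x.1) (hQ x.2)

/-- An `X`-affine element `a₀ + a₁ X` with `a₀, a₁` in the filtration lies in it. [folklore] -/
theorem filtration_affine {a₀ a₁ : Polynomial (MvPolynomial σ E)}
    (h0 : ∀ j, (a₀.coeff j).totalDegree ≤ j) (h1 : ∀ j, (a₁.coeff j).totalDegree ≤ j) :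
    ∀ e j, (((Polynomial.C a₀ + Polynomial.C a₁ * Polynomial.X ^ 1 :
      Polynomial (Polynomial (MvPolynomial σ E))).coeff e).coeff j).totalDegree ≤ j := by
  intro e j
  rw [Polynomial.coeff_add, Polynomial.coeff_C, Polynomial.coeff_C_mul_X_pow]
  by_cases he0 : e = 0
  · subst he0; simpa using h0 j
  · by_cases he1 : e = 1
    · subst he1; simpa using h1 j
    · rw [if_neg he0, if_neg he1, add_zero]; simp

end Filtration

/-! ### The generic plane section `χ` -/

section PlaneSubst

variable {n : ℕ}

/-- **The degree filtration of `χ = f(μ + vX + Y·Z)`:** the coefficient of `Xᵉ Yʲ` in `χ` is a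
polynomial in `Z` of total degree `≤ j`. [cite: CafureMatera2006, §3.2 (proof of Thm. 3.3)] -/
theorem filtration_planeSubst (f : MvPolynomial (Fin n) E) (μ v : Fin n → E) :
    ∀ e j, (((MvPolynomial.aeval (fun i ↦
      (Polynomial.C (Polynomial.C (MvPolynomial.C (μ i))) +
        Polynomial.C (Polynomial.C (MvPolynomial.C (v i))) * Polynomial.X +
        Polynomial.C (Polynomial.C (MvPolynomial.X i) * Polynomial.X) :
          Polynomial (Polynomial (MvPolynomial (Fin n) E)))) f).coeff e).coeff j).totalDegree
      ≤ j := by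
  induction f using MvPolynomial.induction_on with
  | C c =>
    intro e j
    rw [MvPolynomial.aeval_C]
    change (((Polynomial.C (Polynomial.C (C c)) :
      Polynomial (Polynomial (MvPolynomial (Fin n) E))).coeff e).coeff j).totalDegree ≤ j
    rw [Polynomial.coeff_C]
    split_ifs
    · exact filtrationY_C_C c j
    · simp
  | add p q hp hq =>
    rw [map_add]
    exact filtration_add hp hq
  | mul_X p i hp =>
    rw [map_mul, MvPolynomial.aeval_X]
    refine filtration_mul hp ?_
    have hgen : (Polynomial.C (Polynomial.C (MvPolynomial.C (μ i))) +
        Polynomial.C (Polynomial.C (MvPolynomial.C (v i))) * Polynomial.X +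
        Polynomial.C (Polynomial.C (MvPolynomial.X i) * Polynomial.X) :
          Polynomial (Polynomial (MvPolynomial (Fin n) E))) =
        Polynomial.C (Polynomial.C (C (μ i)) + Polynomial.C (X i) * Polynomial.X) +
          Polynomial.C (Polynomial.C (C (v i))) * Polynomial.X ^ 1 := by
      rw [pow_one, map_add]; ring
    rw [hgen]
    exact filtration_affine (filtrationY_add (filtrationY_C_C (μ i)) (filtrationY_X_mul_Y i))
      (filtrationY_C_C (v i))


/-! ### Base change to `E[Z]` and the plane-section bookkeeping -/

/-- Base change along an injective ring map preserves the total degree. [folklore] -/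
theorem totalDegree_map_of_injective {A B : Type*} [CommSemiring A] [CommSemiring B] {τ : Type*}
    (f : MvPolynomial τ A) {φ : A →+* B} (hφ : Function.Injective φ) :
    (MvPolynomial.map φ f).totalDegree = f.totalDegree := by
  rw [totalDegree, totalDegree, support_map_of_injective _ hφ]

/-- Base change commutes with homogeneous components. [folklore] -/
theorem homogeneousComponent_map {A B : Type*} [CommSemiring A] [CommSemiring B] {τ : Type*}
    (f : MvPolynomial τ A) (φ : A →+* B) (k : ℕ) :
    homogeneousComponent k (MvPolynomial.map φ f) =
      MvPolynomial.map φ (homogeneousComponent k f) := by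
  ext m
  rw [coeff_homogeneousComponent, coeff_map, coeff_map, coeff_homogeneousComponent]
  split_ifs <;> simp

/-- Evaluation at constants commutes with `C`: `(map C p)(C ∘ v) = C (p(v))`. [folklore] -/
theorem eval_C_comp_map_C {τ : Type*} (p : MvPolynomial τ E) (v : τ → E) :
    MvPolynomial.eval (fun i ↦ (C (v i) : MvPolynomial σ E)) (MvPolynomial.map C p) =
      C (MvPolynomial.eval v p) := by
  rw [eval_map]
  show eval₂ C (⇑C ∘ v) p = C (eval₂ (RingHom.id E) v p)
  rw [eval₂_comp_left C (RingHom.id E) v p, RingHom.comp_id]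

/-- The generators of `χ` in the shape of `PlaneSectionBookkeepingProofs`:
`μᵢ + vᵢ X + Zᵢ Y = vᵢ · X + (μᵢ + Zᵢ Y)`. [folklore] -/
theorem planeSubst_generator_eq (μ v : Fin n → E) :
    (fun i ↦ (Polynomial.C (Polynomial.C (MvPolynomial.C (μ i))) +
        Polynomial.C (Polynomial.C (MvPolynomial.C (v i))) * Polynomial.X +
        Polynomial.C (Polynomial.C (MvPolynomial.X i) * Polynomial.X) :
          Polynomial (Polynomial (MvPolynomial (Fin n) E)))) =
      fun i ↦ Polynomial.C (Polynomial.C (C (v i) : MvPolynomial (Fin n) E)) * Polynomial.X +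
        Polynomial.C (Polynomial.C (C (μ i)) + Polynomial.C (X i) * Polynomial.X) := by
  funext i
  rw [map_add]
  ring

/-- `χ` is the plane section, over the ring `E[Z]`, of the base change `f_{E[Z]}` of `f` along the
affine-linear forms `vᵢ X + (μᵢ + Zᵢ Y)`. [folklore] -/
theorem planeSubst_eq_aeval_map (f : MvPolynomial (Fin n) E) (μ v : Fin n → E) :
    MvPolynomial.aeval (fun i ↦
      (Polynomial.C (Polynomial.C (MvPolynomial.C (μ i))) +
        Polynomial.C (Polynomial.C (MvPolynomial.C (v i))) * Polynomial.X +
        Polynomial.C (Polynomial.C (MvPolynomial.X i) * Polynomial.X) :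
          Polynomial (Polynomial (MvPolynomial (Fin n) E)))) f =
      MvPolynomial.aeval (fun i ↦
        Polynomial.C (Polynomial.C (C (v i) : MvPolynomial (Fin n) E)) * Polynomial.X +
          Polynomial.C (Polynomial.C (C (μ i)) + Polynomial.C (X i) * Polynomial.X))
        (MvPolynomial.map (C : E →+* MvPolynomial (Fin n) E) f) := by
  rw [planeSubst_generator_eq, ← MvPolynomial.algebraMap_eq, aeval_map_algebraMap]

/-- **Total degree of `χ` in `(X, Y)`:** the coefficient of `Xᵉ Yʲ` vanishes for `e + j > δ`.
[cite: CafureMatera2006, §3.2] -/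
theorem coeff_coeff_planeSubst_eq_zero (f : MvPolynomial (Fin n) E) (μ v : Fin n → E) :
    ∀ e j, f.totalDegree < j + e → ((MvPolynomial.aeval (fun i ↦
      (Polynomial.C (Polynomial.C (MvPolynomial.C (μ i))) +
        Polynomial.C (Polynomial.C (MvPolynomial.C (v i))) * Polynomial.X +
        Polynomial.C (Polynomial.C (MvPolynomial.X i) * Polynomial.X) :
          Polynomial (Polynomial (MvPolynomial (Fin n) E)))) f).coeff e).coeff j = 0 := by
  intro e j h
  rw [planeSubst_eq_aeval_map]
  refine coeff_coeff_aeval_affine_eq_zero _ _ _ (fun i ↦ ?_) e j ?_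
  · refine (Polynomial.natDegree_add_le _ _).trans (max_le ?_ ?_)
    · rw [Polynomial.natDegree_C]; exact Nat.zero_le _
    · exact (Polynomial.natDegree_C_mul_le _ _).trans Polynomial.natDegree_X_le
  · rwa [totalDegree_map_of_injective _ (C_injective _ _)]

/-- **`X`-degree of `χ`:** `deg_X χ ≤ δ`. [cite: CafureMatera2006, §3.2] -/
theorem natDegree_planeSubst_le (f : MvPolynomial (Fin n) E) (μ v : Fin n → E) :
    (MvPolynomial.aeval (fun i ↦
      (Polynomial.C (Polynomial.C (MvPolynomial.C (μ i))) +
        Polynomial.C (Polynomial.C (MvPolynomial.C (v i))) * Polynomial.X +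
        Polynomial.C (Polynomial.C (MvPolynomial.X i) * Polynomial.X) :
          Polynomial (Polynomial (MvPolynomial (Fin n) E)))) f).natDegree ≤ f.totalDegree := by
  rw [Polynomial.natDegree_le_iff_coeff_eq_zero]
  intro e he
  refine Polynomial.ext fun j ↦ ?_
  rw [Polynomial.coeff_zero]
  exact coeff_coeff_planeSubst_eq_zero f μ v e j (by omega)

/-- **`Y`-degree of the `X`-coefficients of `χ`:** the coefficient of `Xᵉ` has `Y`-degree
`≤ δ - e`. [cite: CafureMatera2006, §3.2] -/
theorem natDegree_coeff_planeSubst_le (f : MvPolynomial (Fin n) E) (μ v : Fin n → E) (e : ℕ) :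
    ((MvPolynomial.aeval (fun i ↦
      (Polynomial.C (Polynomial.C (MvPolynomial.C (μ i))) +
        Polynomial.C (Polynomial.C (MvPolynomial.C (v i))) * Polynomial.X +
        Polynomial.C (Polynomial.C (MvPolynomial.X i) * Polynomial.X) :
          Polynomial (Polynomial (MvPolynomial (Fin n) E)))) f).coeff e).natDegree ≤
      f.totalDegree - e := by
  rw [Polynomial.natDegree_le_iff_coeff_eq_zero]
  intro j hj
  exact coeff_coeff_planeSubst_eq_zero f μ v e j (by omega)

/-- **Top `X`-coefficient of `χ`:** the coefficient of `X^δ` is the constant `f_δ(v)`, the top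
homogeneous component of `f` at the direction `v` of the line. [cite: CafureMatera2006, §3.2] -/
theorem coeff_planeSubst_totalDegree (f : MvPolynomial (Fin n) E) (μ v : Fin n → E) :
    (MvPolynomial.aeval (fun i ↦
      (Polynomial.C (Polynomial.C (MvPolynomial.C (μ i))) +
        Polynomial.C (Polynomial.C (MvPolynomial.C (v i))) * Polynomial.X +
        Polynomial.C (Polynomial.C (MvPolynomial.X i) * Polynomial.X) :
          Polynomial (Polynomial (MvPolynomial (Fin n) E)))) f).coeff f.totalDegree =
      Polynomial.C (C (MvPolynomial.eval v (homogeneousComponent f.totalDegree f))) := by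
  rw [planeSubst_eq_aeval_map, ← totalDegree_map_of_injective f (C_injective (Fin n) E),
    coeff_aeval_affine_totalDegree, homogeneousComponent_map, eval_C_comp_map_C,
    totalDegree_map_of_injective f (C_injective (Fin n) E)]

/-! ### Reduction modulo `Y`: `χ(X, 0, Z) = g(X) = f(μ + Xv)` -/

/-- **`χ(X, 0) = g(X)`:** setting `Y = 0` in `χ` gives `g(X) = f(μ + Xv)`, a polynomial with
coefficients in `E ⊆ E[Z]`. [cite: CafureMatera2006, §3.2] -/
theorem map_evalRingHom_zero_planeSubst (f : MvPolynomial (Fin n) E) (μ v : Fin n → E) :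
    (MvPolynomial.aeval (fun i ↦
      (Polynomial.C (Polynomial.C (MvPolynomial.C (μ i))) +
        Polynomial.C (Polynomial.C (MvPolynomial.C (v i))) * Polynomial.X +
        Polynomial.C (Polynomial.C (MvPolynomial.X i) * Polynomial.X) :
          Polynomial (Polynomial (MvPolynomial (Fin n) E)))) f).map
        (Polynomial.evalRingHom (0 : MvPolynomial (Fin n) E)) =
      (MvPolynomial.aeval (fun i ↦ Polynomial.C (μ i) + Polynomial.C (v i) * Polynomial.X :
        Fin n → E[X]) f).map (C : E →+* MvPolynomial (Fin n) E) := by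
  have h : (Polynomial.mapRingHom (Polynomial.evalRingHom (0 : MvPolynomial (Fin n) E))).comp
      (MvPolynomial.aeval (R := E) (fun i ↦
        (Polynomial.C (Polynomial.C (MvPolynomial.C (μ i))) +
          Polynomial.C (Polynomial.C (MvPolynomial.C (v i))) * Polynomial.X +
          Polynomial.C (Polynomial.C (MvPolynomial.X i) * Polynomial.X) :
            Polynomial (Polynomial (MvPolynomial (Fin n) E))))).toRingHom =
      (Polynomial.mapRingHom (C : E →+* MvPolynomial (Fin n) E)).comp
        (MvPolynomial.aeval (R := E)
          (fun i ↦ Polynomial.C (μ i) + Polynomial.C (v i) * Polynomial.X :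
            Fin n → E[X])).toRingHom := by
    refine MvPolynomial.ringHom_ext (fun e ↦ ?_) (fun i ↦ ?_)
    · simp [Polynomial.algebraMap_apply, MvPolynomial.algebraMap_eq]
    · simp
  exact DFunLike.congr_fun h f

end PlaneSubst

end Literature.NumberTheory.DiophantineGeometry
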